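import Mathlib.Analysis.SpecialFunctions.ExpDeriv
import Literature.Analysis.ODE.OneSidedComparison
import HarnessLib

/-!
# Fluid computer blueprint — drain conversion in TIME with the rotor angle as a weight

HONEST FRAMING: low prior, high value-of-information experiment on Tao's machine paradigm; NOT a
claim that NS blows up. Elementary planar ODE estimates; nothing is asserted about any fluid
equation or about the threshold gate itself.

## Why

`DrainRotor.lean` and `DrainBuildUp.lean` state the two phases of the drain conversion for the
unit-speed rotation in the ANGLE variable. On a window of the threshold gate the rotation speed is
`ω(t) = r·c(t)` and the conduit damping is `g(t) = κ·ã(t)` — both time dependent — and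
reparametrising a forced `C⁰` curve with right derivatives by the inverse of its angle is awkward in
Lean. This file proves the SAME two estimates directly in time, with the angle
`Θ(t)` (`Θ(0) = 0`, `Θ' = ω ≥ 0`) entering only as a WEIGHT (integrating factor `exp(λΘ(t))`,
lower barrier `const·Θ(t)`), for the system
`a' = -ω·d + p`, `d' = ω·a - g·d + q`, `|p|, |q| ≤ δ`
— which is literally the `(carrier, conduit)` block of `thresholdCircuit` (`ThresholdGate.lean`)
with `ω = r·c`, `g = κ·ã`, the terms `-εab - σac + μc²` put into `p`:

* `DampedRotor.lyapunov_alg_scaled` — the algebraic heart with the speed `ω ≥ 0` as a factor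
  (damping band `γ₀ω ≤ g ≤ γ₁ω`);
* `DampedRotor.energy_decay_time` — if `γ₀ω ≤ g ≤ γ₁ω` (`0 < γ₀ ≤ γ₁`), `|a|, |d| ≤ R`, `Θ ≤ ΘM`:
  `a(t)² + d(t)² ≤ exp(-λΘ(t))·(3(a(0)² + d(0)²) + 12Rδ·exp(λΘM)·t)`, `λ = γ₀/(3(1 + γ₁²))`;
* `DampedRotor.output_buildup_time` — if `0 ≤ g ≤ γ₁ω`, `γ₁ ≤ 2`, `a² + d² ≥ u₀`, `Φ' ≥ K₀·ω·d²`: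
  `Φ(t) ≥ Φ(0) - K₀R² + (K₀/2)(1 - γ₁/2)u₀·Θ(t) - K₀Rδ·t`.

So on a gate window the conversion is governed by the ANGLE turned (short windows in time cost
nothing), exactly as in the angle-indexed clock budget of `ThresholdTransferAngle.lean`.
[cite: Tao2016AveragedNS, §5.5 (the energy-transfer phase of Thm 5.3)]
-/

noncomputable section

open Set Real

namespace Literature.Analysis.FluidPDE.FluidComputer

open Literature.Analysis.ODE

namespace DampedRotor

/-- The algebraic heart with the rotation speed `ω ≥ 0` as a factor: for `γ₀ω ≤ g ≤ γ₁ω`,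
`0 < γ₀ ≤ γ₁`, `β = γ₀/(1 + γ₁²)`:
`-2g·d² + βω·d² - βω·a² + βg·(ad) ≤ -(β/2)·ω·(a² + d²)`. [folklore] -/
theorem lyapunov_alg_scaled {γ₀ γ₁ ω g a d : ℝ} (hγ₀ : 0 < γ₀) (hγ₁ : γ₀ ≤ γ₁) (hω : 0 ≤ ω)
    (hg : γ₀ * ω ≤ g) (hg₁ : g ≤ γ₁ * ω) :
    -2 * g * d ^ 2 + γ₀ / (1 + γ₁ ^ 2) * ω * d ^ 2 - γ₀ / (1 + γ₁ ^ 2) * ω * a ^ 2 +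
        γ₀ / (1 + γ₁ ^ 2) * g * (a * d) ≤
      -(γ₀ / (1 + γ₁ ^ 2) / 2) * ω * (a ^ 2 + d ^ 2) := by
  set β := γ₀ / (1 + γ₁ ^ 2) with hβ_def
  have h1 : 0 < 1 + γ₁ ^ 2 := by positivity
  have hβ0 : 0 < β := div_pos hγ₀ h1
  have hβγ : β * (1 + γ₁ ^ 2) = γ₀ := by simp only [hβ_def]; field_simp
  have hβle : β ≤ γ₀ := by
    have : β * 1 ≤ β * (1 + γ₁ ^ 2) := mul_le_mul_of_nonneg_left (by nlinarith) hβ0.le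
    linarith
  have hg0 : 0 ≤ g := le_trans (mul_nonneg hγ₀.le hω) hg
  have hγ1 : 0 ≤ γ₁ := hγ₀.le.trans hγ₁
  -- `g·(ad) ≤ γ₁ω|a||d| ≤ ω(a² + γ₁²d²)/2`
  have h2 : g * (a * d) ≤ γ₁ * ω * (|a| * |d|) := by
    have : a * d ≤ |a| * |d| := by rw [← abs_mul]; exact le_abs_self _
    calc g * (a * d) ≤ g * (|a| * |d|) := mul_le_mul_of_nonneg_left this hg0
      _ ≤ γ₁ * ω * (|a| * |d|) := mul_le_mul_of_nonneg_right hg₁ (by positivity)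
  have h3 : 2 * (γ₁ * (|a| * |d|)) ≤ a ^ 2 + γ₁ ^ 2 * d ^ 2 := by
    nlinarith [sq_nonneg (|a| - γ₁ * |d|), sq_abs a, sq_abs d]
  have h3' : γ₁ * ω * (|a| * |d|) ≤ ω * ((a ^ 2 + γ₁ ^ 2 * d ^ 2) / 2) := by
    have := mul_le_mul_of_nonneg_left (by linarith [h3] : γ₁ * (|a| * |d|) ≤
      (a ^ 2 + γ₁ ^ 2 * d ^ 2) / 2) hω
    linarith [this]
  have h4 : β * g * (a * d) ≤ β * ω * (a ^ 2 / 2) + β * γ₁ ^ 2 * ω * (d ^ 2 / 2) := by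
    have := mul_le_mul_of_nonneg_left (h2.trans h3') hβ0.le
    nlinarith [this]
  have h5 : β + β * γ₁ ^ 2 / 2 ≤ γ₀ := by nlinarith [hβγ, hβ0.le, sq_nonneg γ₁]
  have hd2 : 0 ≤ ω * d ^ 2 := by positivity
  have ha2 : 0 ≤ ω * a ^ 2 := by positivity
  -- `g d² ≥ γ₀ ω d²`
  have h6 : γ₀ * (ω * d ^ 2) ≤ g * d ^ 2 := by
    have := mul_le_mul_of_nonneg_right hg (sq_nonneg d); linarith
  nlinarith [h4, h5, hβle, h6, hd2, ha2, hβ0.le, mul_le_mul_of_nonneg_right h5 hd2,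
    mul_le_mul_of_nonneg_right hβle hd2]

variable {a d a' d' ω g Θ Φ Φ' : ℝ → ℝ} {γ₀ γ₁ R δ ΘM K₀ u₀ T : ℝ}

/-- **Energy decay in time, weighted by the angle.** See the module docstring. [folklore] -/
theorem energy_decay_time (hac : ContinuousOn a (Icc 0 T)) (hdc : ContinuousOn d (Icc 0 T))
    (ha' : ∀ s ∈ Ico 0 T, HasDerivWithinAt a (a' s) (Ici s) s)
    (hd' : ∀ s ∈ Ico 0 T, HasDerivWithinAt d (d' s) (Ici s) s)
    (hΘc : ContinuousOn Θ (Icc 0 T)) (hΘ0 : Θ 0 = 0)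
    (hΘ' : ∀ s ∈ Ico 0 T, HasDerivWithinAt Θ (ω s) (Ici s) s) (hΘM : ∀ s ∈ Icc 0 T, Θ s ≤ ΘM)
    (hω : ∀ s ∈ Ico 0 T, 0 ≤ ω s) (hγ₀ : 0 < γ₀) (hγ₁ : γ₀ ≤ γ₁)
    (hg : ∀ s ∈ Ico 0 T, γ₀ * ω s ≤ g s ∧ g s ≤ γ₁ * ω s) (hR : 0 ≤ R) (hδ : 0 ≤ δ)
    (hab : ∀ s ∈ Ico 0 T, |a s| ≤ R ∧ |d s| ≤ R)
    (hp : ∀ s ∈ Ico 0 T, |a' s + ω s * d s| ≤ δ)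
    (hq : ∀ s ∈ Ico 0 T, |d' s - (ω s * a s - g s * d s)| ≤ δ) :
    ∀ t ∈ Icc 0 T, a t ^ 2 + d t ^ 2 ≤
      exp (-(γ₀ / (3 * (1 + γ₁ ^ 2))) * Θ t) *
        (3 * (a 0 ^ 2 + d 0 ^ 2) + 12 * R * δ * exp (γ₀ / (3 * (1 + γ₁ ^ 2)) * ΘM) * t) := by
  intro t ht
  have h1g : 0 < 1 + γ₁ ^ 2 := by positivity
  set β := γ₀ / (1 + γ₁ ^ 2) with hβ_def
  set lam := γ₀ / (3 * (1 + γ₁ ^ 2)) with hlam_def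
  have hβ0 : 0 < β := div_pos hγ₀ h1g
  have hlam0 : 0 < lam := by positivity
  have hlamβ : lam = β / 3 := by simp only [hlam_def, hβ_def]; field_simp
  have hβhalf : β ≤ 1 / 2 := by
    rw [hβ_def, div_le_iff₀ h1g]
    nlinarith [sq_nonneg (γ₁ - 1), hγ₁]
  have hRδ : 0 ≤ R * δ := mul_nonneg hR hδ
  -- Lyapunov function
  set V : ℝ → ℝ := fun s => a s * a s + d s * d s - β * (a s * d s) with hV_def
  set V' : ℝ → ℝ := fun s => (a' s * a s + a s * a' s) + (d' s * d s + d s * d' s) -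
    β * (a' s * d s + a s * d' s) with hV'_def
  have hVc : ContinuousOn V (Icc 0 T) :=
    ((hac.mul hac).add (hdc.mul hdc)).sub (continuousOn_const.mul (hac.mul hdc))
  have hVd : ∀ s ∈ Ico 0 T, HasDerivWithinAt V (V' s) (Ici s) s := fun s hs =>
    (((ha' s hs).mul (ha' s hs)).add ((hd' s hs).mul (hd' s hs))).sub
      (((ha' s hs).mul (hd' s hs)).const_mul β)
  have hsand : ∀ s, (a s ^ 2 + d s ^ 2) / 2 ≤ V s ∧ V s ≤ 3 / 2 * (a s ^ 2 + d s ^ 2) := by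
    intro s
    have h1 : a s * d s ≤ (a s ^ 2 + d s ^ 2) / 2 := by nlinarith [sq_nonneg (a s - d s)]
    have h2 : -(a s * d s) ≤ (a s ^ 2 + d s ^ 2) / 2 := by nlinarith [sq_nonneg (a s + d s)]
    have h3 := mul_le_mul_of_nonneg_left h1 hβ0.le
    have h4 := mul_le_mul_of_nonneg_left h2 hβ0.le
    have h5 : β * ((a s ^ 2 + d s ^ 2) / 2) ≤ 1 / 2 * ((a s ^ 2 + d s ^ 2) / 2) :=
      mul_le_mul_of_nonneg_right hβhalf (by positivity)
    have hV : V s = a s ^ 2 + d s ^ 2 - β * (a s * d s) := by simp only [hV_def]; ring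
    constructor <;> linarith [hV, h3, h4, h5, sq_nonneg (a s), sq_nonneg (d s)]
  -- `V' + lam ω V ≤ 6Rδ`
  have hineq : ∀ s ∈ Ico 0 T, V' s + lam * ω s * V s ≤ 6 * R * δ := by
    intro s hs
    obtain ⟨hgs0, hgs1⟩ := hg s hs
    obtain ⟨haR, hdR⟩ := hab s hs
    have hωs := hω s hs
    set p := a' s + ω s * d s with hp_def
    set q := d' s - (ω s * a s - g s * d s) with hq_def
    have hpδ : |p| ≤ δ := hp s hs
    have hqδ : |q| ≤ δ := hq s hs
    have ea : a' s = -(ω s * d s) + p := by simp only [hp_def]; ring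
    have ed : d' s = ω s * a s - g s * d s + q := by simp only [hq_def]; ring
    have halg := lyapunov_alg_scaled (a := a s) (d := d s) hγ₀ hγ₁ hωs hgs0 hgs1
    rw [← hβ_def] at halg
    have hf1 : a s * p ≤ R * δ := by
      have h := le_abs_self (a s * p); rw [abs_mul] at h
      exact h.trans (mul_le_mul haR hpδ (abs_nonneg p) hR)
    have hf2 : d s * q ≤ R * δ := by
      have h := le_abs_self (d s * q); rw [abs_mul] at h
      exact h.trans (mul_le_mul hdR hqδ (abs_nonneg q) hR)
    have hf3 : -(p * d s) ≤ R * δ := by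
      have h := neg_le_abs (p * d s); rw [abs_mul] at h
      have h2 : |p| * |d s| ≤ δ * R := mul_le_mul hpδ hdR (abs_nonneg _) hδ
      linarith
    have hf4 : -(a s * q) ≤ R * δ := by
      have h := neg_le_abs (a s * q); rw [abs_mul] at h
      exact h.trans (mul_le_mul haR hqδ (abs_nonneg q) hR)
    have hf3' := mul_le_mul_of_nonneg_left hf3 hβ0.le
    have hf4' := mul_le_mul_of_nonneg_left hf4 hβ0.le
    have hβRδ : β * (R * δ) ≤ 1 / 2 * (R * δ) := mul_le_mul_of_nonneg_right hβhalf hRδ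
    have hu : 0 ≤ a s ^ 2 + d s ^ 2 := by positivity
    have hV3 : β / 3 * ω s * V s ≤ β / 2 * ω s * (a s ^ 2 + d s ^ 2) := by
      have := mul_le_mul_of_nonneg_left (hsand s).2 (by positivity : 0 ≤ β / 3 * ω s)
      linarith [this]
    have hid : V' s + lam * ω s * V s =
        (-2 * g s * d s ^ 2 + β * ω s * d s ^ 2 - β * ω s * a s ^ 2 + β * g s * (a s * d s)) +
        (2 * (a s * p) + 2 * (d s * q) + β * (-(p * d s)) + β * (-(a s * q))) +
        β / 3 * ω s * V s := by
      simp only [hV'_def, hV_def, ea, ed, hlamβ]; ring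
    rw [hid]
    linarith [halg, hf1, hf2, hf3', hf4', hβRδ, hV3, hRδ]
  -- `W = exp(lam Θ) V` has `W' ≤ 6Rδ exp(lam ΘM)`
  have hE : ∀ s ∈ Ico 0 T, HasDerivWithinAt (fun x => exp (lam * Θ x))
      (exp (lam * Θ s) * (lam * ω s)) (Ici s) s :=
    fun s hs => ((hΘ' s hs).const_mul lam).exp
  have hWc : ContinuousOn (fun s => exp (lam * Θ s) * V s) (Icc 0 T) :=
    ((continuousOn_const.mul hΘc).rexp).mul hVc
  have hWd : ∀ s ∈ Ico 0 T, HasDerivWithinAt (fun x => exp (lam * Θ x) * V x)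
      (exp (lam * Θ s) * (lam * ω s) * V s + exp (lam * Θ s) * V' s) (Ici s) s :=
    fun s hs => (hE s hs).mul (hVd s hs)
  set M := 6 * R * δ * exp (lam * ΘM) with hM_def
  have hbd : ∀ s ∈ Ico 0 T,
      exp (lam * Θ s) * (lam * ω s) * V s + exp (lam * Θ s) * V' s ≤ M := by
    intro s hs
    have hes : 0 < exp (lam * Θ s) := exp_pos _
    have h1 : exp (lam * Θ s) * (lam * ω s) * V s + exp (lam * Θ s) * V' s =
        exp (lam * Θ s) * (V' s + lam * ω s * V s) := by ring
    rw [h1]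
    have h2 : exp (lam * Θ s) * (V' s + lam * ω s * V s) ≤ exp (lam * Θ s) * (6 * R * δ) :=
      mul_le_mul_of_nonneg_left (hineq s hs) hes.le
    have h3 : exp (lam * Θ s) ≤ exp (lam * ΘM) :=
      exp_le_exp.2 (mul_le_mul_of_nonneg_left (hΘM s (Ico_subset_Icc_self hs)) hlam0.le)
    have h4 := mul_le_mul_of_nonneg_right h3 (by positivity : (0:ℝ) ≤ 6 * R * δ)
    simp only [hM_def]; linarith
  have hmain := sub_le_mul_of_deriv_right_le hWc hWd hbd t ht
  simp only [hΘ0, mul_zero, exp_zero, one_mul, sub_zero] at hmain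
  -- unwind
  have het : 0 < exp (lam * Θ t) := exp_pos _
  have hexp_neg : exp (-lam * Θ t) = (exp (lam * Θ t))⁻¹ := by
    rw [← exp_neg]; congr 1; ring
  have hM0 : 0 ≤ M := by positivity
  have hVt : V t ≤ (exp (lam * Θ t))⁻¹ * (V 0 + M * t) := by
    rw [le_inv_mul_iff₀ het]; linarith
  have hV0 := (hsand 0).2
  have hlo := (hsand t).1
  have hi0 : 0 ≤ (exp (lam * Θ t))⁻¹ := inv_nonneg.2 het.le
  have hm := mul_le_mul_of_nonneg_left
    (by linarith [hV0] : V 0 + M * t ≤ 3 / 2 * (a 0 ^ 2 + d 0 ^ 2) + M * t) hi0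
  rw [hexp_neg]
  have e : (exp (lam * Θ t))⁻¹ * (3 * (a 0 ^ 2 + d 0 ^ 2) + 12 * R * δ * exp (lam * ΘM) * t) =
      2 * ((exp (lam * Θ t))⁻¹ * (3 / 2 * (a 0 ^ 2 + d 0 ^ 2) + M * t)) := by
    simp only [hM_def]; ring
  rw [e]
  linarith [hlo, hVt, hm]

/-- **Output build-up in time, weighted by the angle.** See the module docstring. [folklore] -/
theorem output_buildup_time (hac : ContinuousOn a (Icc 0 T)) (hdc : ContinuousOn d (Icc 0 T))
    (hΦc : ContinuousOn Φ (Icc 0 T))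
    (ha' : ∀ s ∈ Ico 0 T, HasDerivWithinAt a (a' s) (Ici s) s)
    (hd' : ∀ s ∈ Ico 0 T, HasDerivWithinAt d (d' s) (Ici s) s)
    (hΦ' : ∀ s ∈ Ico 0 T, HasDerivWithinAt Φ (Φ' s) (Ici s) s)
    (hΘc : ContinuousOn Θ (Icc 0 T)) (hΘ0 : Θ 0 = 0)
    (hΘ' : ∀ s ∈ Ico 0 T, HasDerivWithinAt Θ (ω s) (Ici s) s) (hω : ∀ s ∈ Ico 0 T, 0 ≤ ω s)
    (hK₀ : 0 ≤ K₀) (hK : ∀ s ∈ Ico 0 T, K₀ * ω s * d s ^ 2 ≤ Φ' s)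
    (hg : ∀ s ∈ Ico 0 T, 0 ≤ g s ∧ g s ≤ γ₁ * ω s) (hγ₁ : γ₁ ≤ 2) (hR : 0 ≤ R) (hδ : 0 ≤ δ)
    (hab : ∀ s ∈ Icc 0 T, |a s| ≤ R ∧ |d s| ≤ R) (hu : ∀ s ∈ Ico 0 T, u₀ ≤ a s ^ 2 + d s ^ 2)
    (hp : ∀ s ∈ Ico 0 T, |a' s + ω s * d s| ≤ δ)
    (hq : ∀ s ∈ Ico 0 T, |d' s - (ω s * a s - g s * d s)| ≤ δ) :
    ∀ t ∈ Icc 0 T,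
      Φ 0 - K₀ * R ^ 2 + K₀ / 2 * ((1 - γ₁ / 2) * u₀) * Θ t - K₀ * R * δ * t ≤ Φ t := by
  intro t ht
  set Ψ : ℝ → ℝ := fun s => Φ s + K₀ / 2 * (a s * d s) with hΨ_def
  set Ψ' : ℝ → ℝ := fun s => Φ' s + K₀ / 2 * (a' s * d s + a s * d' s) with hΨ'_def
  have hΨc : ContinuousOn Ψ (Icc 0 T) := hΦc.add (continuousOn_const.mul (hac.mul hdc))
  have hΨd : ∀ s ∈ Ico 0 T, HasDerivWithinAt Ψ (Ψ' s) (Ici s) s := fun s hs =>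
    (hΦ' s hs).add (((ha' s hs).mul (hd' s hs)).const_mul _)
  set cst := K₀ / 2 * ((1 - γ₁ / 2) * u₀) with hcst_def
  -- lower barrier `B = Ψ 0 + cst Θ - K₀Rδ t`
  set B : ℝ → ℝ := fun s => Ψ 0 + cst * Θ s - K₀ * R * δ * s with hB_def
  have hBc : ContinuousOn B (Icc 0 T) :=
    (continuousOn_const.add (continuousOn_const.mul hΘc)).sub
      (continuousOn_const.mul continuousOn_id)
  have hBd : ∀ s ∈ Ico 0 T, HasDerivWithinAt B (cst * ω s - K₀ * R * δ * 1) (Ici s) s :=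
    fun s hs => (((hΘ' s hs).const_mul cst).const_add _).sub
      ((hasDerivWithinAt_id s _).const_mul _)
  have hslope : ∀ s ∈ Ico 0 T, cst * ω s - K₀ * R * δ * 1 ≤ Ψ' s := by
    intro s hs
    obtain ⟨hg0, hg1⟩ := hg s hs
    obtain ⟨haR, hdR⟩ := hab s (Ico_subset_Icc_self hs)
    have hωs := hω s hs
    set p := a' s + ω s * d s with hp_def
    set q := d' s - (ω s * a s - g s * d s) with hq_def
    have hpδ : |p| ≤ δ := hp s hs
    have hqδ : |q| ≤ δ := hq s hs
    have ea : a' s = -(ω s * d s) + p := by simp only [hp_def]; ring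
    have ed : d' s = ω s * a s - g s * d s + q := by simp only [hq_def]; ring
    have had : |a s * d s| ≤ (a s ^ 2 + d s ^ 2) / 2 := by
      rw [abs_le]; constructor <;> nlinarith [sq_nonneg (a s + d s), sq_nonneg (a s - d s)]
    have hγ1ω : 0 ≤ γ₁ * ω s := hg0.trans hg1
    have hgad : g s * (a s * d s) ≤ γ₁ * ω s * ((a s ^ 2 + d s ^ 2) / 2) :=
      (mul_le_mul_of_nonneg_left (le_abs_self _) hg0).trans
        (mul_le_mul hg1 had (abs_nonneg _) hγ1ω)
    have hf1 : -(p * d s) ≤ R * δ := by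
      have h := neg_le_abs (p * d s); rw [abs_mul] at h
      have h2 : |p| * |d s| ≤ δ * R := mul_le_mul hpδ hdR (abs_nonneg _) hδ
      linarith
    have hf2 : -(a s * q) ≤ R * δ := by
      have h := neg_le_abs (a s * q); rw [abs_mul] at h
      exact h.trans (mul_le_mul haR hqδ (abs_nonneg q) hR)
    have hus := hu s hs
    have h12 : 0 ≤ 1 - γ₁ / 2 := by linarith
    have hid : Ψ' s = Φ' s + K₀ / 2 * (ω s * (a s ^ 2 + d s ^ 2) - 2 * (ω s * d s ^ 2) -
        g s * (a s * d s) + (p * d s) + (a s * q)) := by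
      simp only [hΨ'_def, ea, ed]; ring
    have hK2 : 0 ≤ K₀ / 2 := by linarith
    -- `ω u - g ad ≥ ω (1 - γ₁/2) u ≥ ω (1 - γ₁/2) u₀`
    have hc1 : ω s * ((1 - γ₁ / 2) * u₀) ≤ ω s * (a s ^ 2 + d s ^ 2) - g s * (a s * d s) := by
      have h1 := mul_le_mul_of_nonneg_left (mul_le_mul_of_nonneg_left hus h12) hωs
      nlinarith [h1, hgad]
    have hcore : ω s * ((1 - γ₁ / 2) * u₀) - 2 * R * δ ≤
        ω s * (a s ^ 2 + d s ^ 2) - g s * (a s * d s) + (p * d s) + (a s * q) := by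
      linarith [hc1, hf1, hf2]
    have hKd := hK s hs
    have h2 := mul_le_mul_of_nonneg_left hcore hK2
    rw [hid]
    simp only [hcst_def]
    nlinarith [h2, hKd]
  have hcmp := image_le_of_deriv_right_le_deriv_boundary hBc hBd
    (B := Ψ) (B' := Ψ') (by simp [hB_def, hΘ0]) hΨc hΨd hslope ht
  simp only [hB_def, hΨ_def] at hcmp
  have hend : ∀ s ∈ Icc 0 T, |a s * d s| ≤ R ^ 2 := by
    intro s hs
    obtain ⟨haR, hdR⟩ := hab s hs
    rw [abs_mul, sq]; exact mul_le_mul haR hdR (abs_nonneg _) hR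
  have h0 := (abs_le.1 (hend 0 ⟨le_rfl, ht.1.trans ht.2⟩)).1
  have ht' := (abs_le.1 (hend t ht)).2
  have hK2 : 0 ≤ K₀ / 2 := by linarith
  have h0' := mul_le_mul_of_nonneg_left h0 hK2
  have ht'' := mul_le_mul_of_nonneg_left ht' hK2
  simp only [hcst_def] at hcmp ⊢
  linarith [hcmp, h0', ht'']

end DampedRotor

end Literature.Analysis.FluidPDE.FluidComputer

end
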